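import Summits.BirchSwinnertonDyer.Rank1Residual.Additive.GordTwistDegreeIdentityGood
import Summits.BirchSwinnertonDyer.Rank1Residual.Additive.GordManinConstantTwistDegree
import Literature.NumberTheory.DiophantineGeometry.ConductorExponentZeroProofs
import HarnessLib

/-!
# X3/X4 at an additive prime: THE MANIN BINDER ON THE `I₀*` CELL FROM THE GOOD TWIST'S DEGREE —
# `v_p(deg D_W) + 2 v_p(c(D_V)) = v_p((p+1)² − a_p(V)²) + v_p(deg D_V) + 2 v_p(c(D_W))`, hence
# `p ∤ deg(D_V) ∧ v_p(deg D_W) = v_p((p+1)² − a_p(V)²) ⟹ p ∤ c(D_W)` (every `p ≥ 5`)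

HONEST FRAMING (cell `b2b-bsdres`, run/shared/lean/b2b/bsd-rank1-residual/, verbatim in every
file): the goal of the cell is to DELETE the COMBINATION-SHAPED residual classes of the
Birch–Swinnerton-Dyer formula for ALL analytic-rank `≤ 1` elliptic curves over `ℚ` — "full BSD
formula for every rank `≤ 1` curve in class `C`" assembled STRICTLY from published theorems — so
that the rank-`≤ 1` remainder becomes exactly the CONSTRUCTION-SHAPED classes, which are TYPED
(missing-input `Prop`s), NOT attempted. This is not "finishing BSD". Sub-cell `additive-p2`
(CLASS-OWNERS row "X3/X4 additive — pot. good ordinary / X3♯(G-ord)"), generation 17: research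
route; no claim beyond the stated classes; theorems only, no definition, no new named fact (`hCNS`
= A159 and the cell's standing binders enter as hypotheses); X3♯(G-ord)/X4♯(G-ord) stay
CONSTRUCTION-SHAPED; no label moves; nothing is booked.

WHAT THIS FILE DOES. The defect-`2` part of the (G)-ordinary cell — Kodaira `I₀*`, `681` of the
`1 280` window pairs — is the twist `W = V ⊗ χ_{p*}` of a curve `V` GOOD ORDINARY at `p`, conductor
`N(W) = p²·N(V)`. At `p ≥ 11` Edixhoven discharges the Manin datum there (gen 14); at `p ∈ {5, 7}`
only Česnavičius–Neururer–Saha `p ∤ deg(D_W)` did (gen 16: `38–63 %` of the rows). Watkins'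
`V_p = (p−1)(p+1−a_p)(p+1+a_p)` (kernel: `twist_modularDegree_identity_good`,
`GordTwistDegreeIdentityGood.lean`) transfers the datum from the GOOD twist:
* §1 `conductorNorm_eq_sq_mul_of_twist_pStar_of_good` — **`N(W) = p²·N(V)`** for `V` good at `p`,
  `W` additive at `p ≥ 5`, `C • V^{(p*)} = W` (`f_q` equal off `p` by gen 17's
  `conductorExponent_eq_of_twist_pStar_of_ne`; `f_p(W) = 2`, `f_p(V) = 0`); `not_dvd_conductorNorm_of_good`.
* §2 **`padicVal_twist_identity_good`** — for `V, W` globally minimal, `V` good at `p ≥ 5`, `W`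
  additive, `C • V^{(p*)} = W`, `D`/`D'` conductor-level data of `V`/`W` (ANY data):
  `v_p(deg D') + 2·v_p(c(D)) = v_p((p+1)² − a_p(V)²) + v_p(deg D) + 2·v_p(c(D'))`
  (`ord_p u(C) = 0` is additive-p4's `padicValRat_u_eq_zero_of_twist_pm_p`, Pal 2012 Prop 2.5;
  `p ∤ p − 1`).
* §3 (CNS `hCNS`, EVERY `p ≥ 5`, NO optimality): **`Addv.not_dvd_maninConstant_of_goodTwistDegrees`:
  `p ∤ deg(D) ∧ v_p(deg D') = v_p((p+1)² − a_p(V)²) ⟹ p ∤ c(D')`** — the Manin datum of the `I₀*`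
  member from the good twist's degree and ONE point count; and `p ∤ deg(D) ⟹ v_p(deg D') ≥
  v_p((p+1)² − a_p²)` with equal parity (why `p ∣ deg` on the anomalous-type rows `a_p ≡ ±1`).
* §4 consumers on class X4 / X4♯(G-ord) ∩ I₀* (Kim rank `0` on the `p ∤ #Ш_an` rows; BOTH ranks from
  the lower halves of the same-`j` X4 pairs).
Census (`HOME/b2b-bsdres-additive-p2/census/gen17b/`): I₀* (G-ord) X4, `r ≤ 1`: the criterion fires
on `22 257 / 35 762` pairs at `p = 5` (CNS direct: `13 661`), `17 996 / 22 652` at `p = 7`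
(`14 039`); rank-`0` binder-complete rows at `N > 130 000`: `p = 5`: `7 184 / 11 036` (CNS `4 388`),
`p = 7`: `6 208 / 7 736` (`4 716`). Labels UNCHANGED (the LOWER half is untouched); nothing booked.

References: M. Watkins, Experiment. Math. 11 (2002) §2.1 p. 491 [Watkins2002]; K. Česnavičius,
M. Neururer, A. Saha, JEMS 26 (2024) Thm. 1.2 [CesnaviciusNeururerSaha2023]; V. Pal, PAMS 140
(2012) Prop. 2.5 [Pal2012]; C.-H. Kim, AJM 148 (2026) Thm. 1.8 [Kim2022StructureSelmer];
J. H. Silverman, *AEC* C.16, VII.1.3(b) [SilvermanAEC2009].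
-/

noncomputable section

open scoped Classical NumberField

open WeierstrassCurve IsDedekindDomain IsDedekindDomain.HeightOneSpectrum NumberField
  Rat.HeightOneSpectrum Literature.NumberTheory.EllipticCurves
  Literature.NumberTheory.EllipticCurves.ModularForms
  Literature.NumberTheory.EllipticCurves.Rank1Residual
  Literature.NumberTheory.EllipticCurves.Rank1Residual.Typed
  Literature.NumberTheory.DiophantineGeometry

namespace Summit.BirchSwinnertonDyer.Rank1Residual.Additive

variable (p : ℕ) [hp : Fact p.Prime]

/-! ### §1 The conductor of the twist of a good curve: `N(W) = p² · N(V)` -/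

/-- **`p ∤ N(V)` when `V` is good at `p`** (`f_p(V) = 0`, tree `conductorExponent_eq_zero_iff_holds`;
`N = ∏ p^{f_p}`, `factorization_conductorNorm_holds`). [cite: SilvermanAEC2009, C.16] -/
theorem not_dvd_conductorNorm_of_good (V : WeierstrassCurve ℚ) [V.IsElliptic] (hV : Good V p) :
    ¬ p ∣ V.conductorNorm ℤ := by
  have hgood : V.HasGoodReductionAt (placeOf p) :=
    (V.hasGoodReductionAtPrime_iff_hasGoodReductionAt_holds ⟨p, hp.out⟩).mp hV
  have hf : V.conductorExponent (placeOf p) = 0 :=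
    (conductorExponent_eq_zero_iff_holds (placeOf p) V).mpr hgood
  have hfac := V.factorization_conductorNorm_holds (placeOf p)
  rw [natGenerator_placeOf_eq, hf] at hfac
  intro hdvd
  have hpos : 0 < V.conductorNorm ℤ := V.conductorNorm_pos_holds
  have := (hp.out.dvd_iff_one_le_factorization hpos.ne').mp hdvd
  omega

/-- **`N(W) = p² · N(V)`** for `C • V^{(p*)} = W` with `V` GOOD at `p` and `W` ADDITIVE at `p ≥ 5`:
the conductor exponents agree away from `p` (`conductorExponent_eq_of_twist_pStar_of_ne`, unramified
twist), `f_p(W) = 2` (`condExpTwo_of_addv_of_five_le`) and `f_p(V) = 0`. [cite: SilvermanAEC2009, C.16]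
[cite: SilvermanATAEC1994, IV.9.4 (PDF pp. 344–346)] -/
theorem conductorNorm_eq_sq_mul_of_twist_pStar_of_good (hp5 : 5 ≤ p) (V W : WeierstrassCurve ℚ)
    [V.IsElliptic] [W.IsElliptic] [W.IsGloballyMinimal] (hV : Good V p) (hW : Addv W p)
    (C : VariableChange ℚ) (hC : C • V.quadraticTwist ((-1 : ℚ) ^ (p / 2) * p) = W) :
    W.conductorNorm ℤ = p ^ 2 * V.conductorNorm ℤ := by
  have hp2 : p ≠ 2 := by omega
  have hNV : V.conductorNorm ℤ ≠ 0 := (V.conductorNorm_pos_holds).ne'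
  have hNW : W.conductorNorm ℤ ≠ 0 := (W.conductorNorm_pos_holds).ne'
  have hgood : V.HasGoodReductionAt (placeOf p) :=
    (V.hasGoodReductionAtPrime_iff_hasGoodReductionAt_holds ⟨p, hp.out⟩).mp hV
  have hfV : V.conductorExponent (placeOf p) = 0 :=
    (conductorExponent_eq_zero_iff_holds (placeOf p) V).mpr hgood
  have hfW : W.conductorExponent (placeOf p) = 2 := condExpTwo_of_addv_of_five_le W p hp5 hW
  refine Nat.eq_of_factorization_eq hNW (mul_ne_zero (pow_ne_zero _ hp.out.ne_zero) hNV) fun q ↦ ?_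
  rw [Nat.factorization_mul (pow_ne_zero _ hp.out.ne_zero) hNV, Finsupp.add_apply,
    hp.out.factorization_pow, Finsupp.single_apply]
  by_cases hq : q.Prime
  · haveI : Fact q.Prime := ⟨hq⟩
    have hgen : natGenerator (placeOf q) = q := natGenerator_placeOf_eq q
    have hW' := W.factorization_conductorNorm_holds (placeOf q)
    have hV' := V.factorization_conductorNorm_holds (placeOf q)
    rw [hgen] at hW' hV'
    rw [hW', hV']
    by_cases hqp : q = p
    · subst hqp
      rw [hfW, hfV]
      simp
    · rw [if_neg (Ne.symm hqp), conductorExponent_eq_of_twist_pStar_of_ne p hp2 V W C hC (placeOf q)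
        (by rw [hgen]; exact hqp)]
      simp
  · rw [Nat.factorization_eq_zero_of_not_prime _ hq, Nat.factorization_eq_zero_of_not_prime _ hq]
    have : p ≠ q := fun h ↦ hq (h ▸ hp.out)
    simp [this]

/-! ### §2 The `p`-adic identity on the `I₀*` cell -/

/-- Arithmetic bridge: from `deg'·u²·c² = (p−1)·A·deg·c'²` with `ord_p u = 0`, `A > 0` an integer
(`p ∤ p − 1`): `v_p(deg') + 2v_p(c) = v_p(A) + v_p(deg) + 2v_p(c')`. [folklore] -/
theorem padicVal_identity_good_of_rat_identity {deg deg' : ℕ} {c c' A : ℤ} {u : ℚ}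
    (hdeg : 0 < deg) (hdeg' : 0 < deg') (hc : c ≠ 0) (hc' : c' ≠ 0) (hA : A ≠ 0) (hu0 : u ≠ 0)
    (hu : padicValRat p u = 0)
    (h : (deg' : ℚ) * u ^ 2 * (c : ℚ) ^ 2 = ((p : ℚ) - 1) * A * deg * (c' : ℚ) ^ 2) :
    padicValNat p deg' + 2 * padicValInt p c = padicValInt p A + padicValNat p deg + 2 * padicValInt p c' := by
  have hpq : (p : ℚ) ≠ 0 := by exact_mod_cast hp.out.ne_zero
  have hdq : (deg : ℚ) ≠ 0 := by exact_mod_cast hdeg.ne'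
  have hdq' : (deg' : ℚ) ≠ 0 := by exact_mod_cast hdeg'.ne'
  have hcq : (c : ℚ) ≠ 0 := by exact_mod_cast hc
  have hcq' : (c' : ℚ) ≠ 0 := by exact_mod_cast hc'
  have hAq : (A : ℚ) ≠ 0 := by exact_mod_cast hA
  have hp1 : ((p : ℚ) - 1) ≠ 0 := by
    have : (1 : ℚ) < p := by exact_mod_cast hp.out.one_lt
    linarith
  -- `ord_p (p - 1) = 0`
  have hpm1 : padicValRat p ((p : ℚ) - 1) = 0 := by
    have hcast : ((p : ℚ) - 1) = ((p - 1 : ℕ) : ℚ) := by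
      rw [Nat.cast_sub hp.out.one_lt.le]; simp
    rw [hcast, padicValRat.of_nat]
    have : ¬ p ∣ p - 1 := by
      intro hd
      have h2 := hp.out.two_le
      have := Nat.le_of_dvd (by omega) hd
      omega
    simp [padicValNat.eq_zero_of_not_dvd this]
  have L : padicValRat p ((deg' : ℚ) * u ^ 2 * (c : ℚ) ^ 2) =
      padicValNat p deg' + 2 * padicValRat p u + 2 * padicValInt p c := by
    rw [padicValRat.mul (mul_ne_zero hdq' (pow_ne_zero _ hu0)) (pow_ne_zero _ hcq),
      padicValRat.mul hdq' (pow_ne_zero _ hu0), padicValRat.pow, padicValRat.pow,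
      padicValRat.of_nat, padicValRat.of_int]
    push_cast
    ring
  have R : padicValRat p (((p : ℚ) - 1) * A * deg * (c' : ℚ) ^ 2) =
      padicValRat p ((p : ℚ) - 1) + padicValInt p A + padicValNat p deg + 2 * padicValInt p c' := by
    rw [padicValRat.mul (mul_ne_zero (mul_ne_zero hp1 hAq) hdq) (pow_ne_zero _ hcq'),
      padicValRat.mul (mul_ne_zero hp1 hAq) hdq, padicValRat.mul hp1 hAq, padicValRat.pow,
      padicValRat.of_nat, padicValRat.of_int, padicValRat.of_int]
    push_cast
    ring
  have key := congrArg (padicValRat p) h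
  rw [L, R, hu, hpm1] at key
  simp only [mul_zero, add_zero, zero_add] at key
  omega

/-- **THE `p`-ADIC TWIST IDENTITY ON THE `I₀*` CELL.** Let `p ≥ 5`, `V/ℚ` globally minimal and GOOD
at `p`, `W` globally minimal and ADDITIVE at `p` with `C • V^{(p*)} = W` (so `W` is of Kodaira type
`I₀*` at `p`, `N(W) = p² N(V)`), `D`, `D'` conductor-level parametrisation data of `V`, `W` (ANY
data). Then **`v_p(deg D') + 2 v_p(c(D)) = v_p((p+1)² − a_p(V)²) + v_p(deg D) + 2 v_p(c(D'))`**
(`twist_modularDegree_identity_good` + `ord_p u(C) = 0`, additive-p4's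
`padicValRat_u_eq_zero_of_twist_pm_p`). [cite: Watkins2002, §2.1 (p. 491)] [cite: Pal2012, Prop. 2.5] -/
theorem padicVal_twist_identity_good (hp5 : 5 ≤ p) (V W : WeierstrassCurve ℚ) [V.IsElliptic]
    [V.IsGloballyMinimal] [W.IsElliptic] [W.IsGloballyMinimal] (hV : Good V p) (hW : Addv W p)
    (C : VariableChange ℚ) (hC : C • V.quadraticTwist ((-1 : ℚ) ^ (p / 2) * p) = W)
    [NeZero (V.conductorNorm ℤ)] [NeZero (W.conductorNorm ℤ)]
    (D : ModularParametrizationData V (V.conductorNorm ℤ))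
    (D' : ModularParametrizationData W (W.conductorNorm ℤ)) :
    padicValNat p D'.modularDegree + 2 * padicValInt p D.maninConstant =
      padicValInt p (((p : ℤ) + 1) ^ 2 - (V.LFunction p) ^ 2) + padicValNat p D.modularDegree +
        2 * padicValInt p D'.maninConstant := by
  have hp2 : p ≠ 2 := by omega
  obtain ⟨hcast, hd⟩ := pStar_intCast p
  have hC' : C • V.quadraticTwist (((-1 : ℤ) ^ (p / 2) * p : ℤ) : ℚ) = W := by rw [hcast]; exact hC
  have hu := padicValRat_u_eq_zero_of_twist_pm_p p hp2 V W (Or.inl hV) hd C hC'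
  have hN := conductorNorm_eq_sq_mul_of_twist_pStar_of_good p hp5 V W hV hW C hC
  have hpM := not_dvd_conductorNorm_of_good p V hV
  have hid := twist_modularDegree_identity_good p hp2 V W hW C hC hN hpM D D'
  -- Hasse: `A = (p+1)² − a_p² > 0`
  have hH := D.isNewformOf.norm_cuspCoeff_prime_pow_sq_le hp.out 1
  rw [pow_one, pow_one, D.isNewformOf.2 p, Complex.norm_intCast, sq_abs] at hH
  norm_num at hH
  have hp1 : (1 : ℝ) < p := by exact_mod_cast hp.out.one_lt
  have hApos : (0 : ℝ) < ((p : ℝ) + 1) ^ 2 - ((V.LFunction p : ℤ) : ℝ) ^ 2 := by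
    nlinarith [hH, hp1, sq_nonneg ((p : ℝ) - 1)]
  have hA : (((p : ℤ) + 1) ^ 2 - (V.LFunction p) ^ 2) ≠ 0 := by
    intro h0
    have : (((p : ℤ) + 1) ^ 2 - (V.LFunction p) ^ 2 : ℤ) = (0 : ℤ) := h0
    have h' : ((p : ℝ) + 1) ^ 2 - ((V.LFunction p : ℤ) : ℝ) ^ 2 = 0 := by exact_mod_cast this
    linarith
  have hidQ : (D'.modularDegree : ℚ) * (C.u : ℚ) ^ 2 * (D.maninConstant : ℚ) ^ 2 =
      ((p : ℚ) - 1) * ((((p : ℤ) + 1) ^ 2 - (V.LFunction p) ^ 2 : ℤ) : ℚ) * D.modularDegree *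
        (D'.maninConstant : ℚ) ^ 2 := by
    have h' : (((D'.modularDegree : ℚ) * (C.u : ℚ) ^ 2 * (D.maninConstant : ℚ) ^ 2 : ℚ) : ℝ) =
        ((((p : ℚ) - 1) * ((((p : ℤ) + 1) ^ 2 - (V.LFunction p) ^ 2 : ℤ) : ℚ) * D.modularDegree *
          (D'.maninConstant : ℚ) ^ 2 : ℚ) : ℝ) := by
      push_cast
      linear_combination hid
    exact_mod_cast h'
  exact padicVal_identity_good_of_rat_identity p D.deg_pos D'.deg_pos D.maninConstant_ne_zero_holds
    D'.maninConstant_ne_zero_holds hA C.u.ne_zero hu hidQ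

/-! ### §3 Česnavičius–Neururer–Saha: the Manin datum of the `I₀*` member from the good twist -/

/-- **`p ∤ deg(D) ⟹ v_p(deg D') = v_p((p+1)² − a_p(V)²) + 2 v_p(c(D'))`** (CNS on the good twist's
datum: `v_p(c(D)) ≤ v_p(deg D) = 0`). So `p ∣ deg(D')` exactly when `a_p(V) ≡ ±1 (mod p)` or
`p ∣ c(D')`. [cite: CesnaviciusNeururerSaha2023, Thm. 1.2] [cite: Watkins2002, §2.1 (p. 491)] -/
theorem padicValNat_modularDegree_eq_of_goodTwist_of_not_dvd
    (hCNS : cesnaviciusNeururerSaha_padicVal_maninConstant_le_modularDegree)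
    (hp5 : 5 ≤ p) (V W : WeierstrassCurve ℚ) [V.IsElliptic]
    [V.IsGloballyMinimal] [W.IsElliptic] [W.IsGloballyMinimal] (hV : Good V p) (hW : Addv W p)
    (C : VariableChange ℚ) (hC : C • V.quadraticTwist ((-1 : ℚ) ^ (p / 2) * p) = W)
    [NeZero (V.conductorNorm ℤ)] [NeZero (W.conductorNorm ℤ)]
    (D : ModularParametrizationData V (V.conductorNorm ℤ))
    (D' : ModularParametrizationData W (W.conductorNorm ℤ)) (hdeg : ¬ p ∣ D.modularDegree) :
    padicValNat p D'.modularDegree =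
      padicValInt p (((p : ℤ) + 1) ^ 2 - (V.LFunction p) ^ 2) + 2 * padicValInt p D'.maninConstant := by
  have h := padicVal_twist_identity_good p hp5 V W hV hW C hC D D'
  have h0 : padicValNat p D.modularDegree = 0 := padicValNat.eq_zero_of_not_dvd hdeg
  have hle := padicVal_maninConstant_le_modularDegree_of_five_le hCNS V D hp.out hp5
  rw [h0] at hle h
  have hc0 : padicValInt p D.maninConstant = 0 := by omega
  omega

/-- **THE MANIN DATUM OF THE `I₀*` MEMBER FROM THE GOOD TWIST'S DEGREE:
`p ∤ deg(D) ∧ v_p(deg D') = v_p((p+1)² − a_p(V)²) ⟹ p ∤ c(D')`** (`p ≥ 5`; `V` the globally minimal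
good twist with a conductor-level datum `D`; `W = V ⊗ χ_{p*}` additive with datum `D'`; NO optimality,
NO Edixhoven — `p ∈ {5, 7}` INCLUDED). [cite: CesnaviciusNeururerSaha2023, Thm. 1.2]
[cite: Watkins2002, §2.1 (p. 491)] -/
theorem Addv.not_dvd_maninConstant_of_goodTwistDegrees
    (hCNS : cesnaviciusNeururerSaha_padicVal_maninConstant_le_modularDegree)
    (hp5 : 5 ≤ p) (V W : WeierstrassCurve ℚ) [V.IsElliptic]
    [V.IsGloballyMinimal] [W.IsElliptic] [W.IsGloballyMinimal] (hV : Good V p) (hW : Addv W p)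
    (C : VariableChange ℚ) (hC : C • V.quadraticTwist ((-1 : ℚ) ^ (p / 2) * p) = W)
    [NeZero (V.conductorNorm ℤ)] [NeZero (W.conductorNorm ℤ)]
    (D : ModularParametrizationData V (V.conductorNorm ℤ))
    (D' : ModularParametrizationData W (W.conductorNorm ℤ)) (hdeg : ¬ p ∣ D.modularDegree)
    (hv : padicValNat p D'.modularDegree = padicValInt p (((p : ℤ) + 1) ^ 2 - (V.LFunction p) ^ 2)) :
    ¬ (p : ℤ) ∣ D'.maninConstant := by
  have h := padicValNat_modularDegree_eq_of_goodTwist_of_not_dvd p hCNS hp5 V W hV hW C hC D D' hdeg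
  have hc0 : padicValInt p D'.maninConstant = 0 := by omega
  intro hdvd
  have hne : D'.maninConstant ≠ 0 := D'.maninConstant_ne_zero_holds
  rcases (padicValInt_dvd_iff (p := p) 1 D'.maninConstant).mp (by rwa [pow_one]) with h0 | h1
  · exact hne h0
  · omega

/-! ### §4 Consumers on class X4 ∩ I₀* -/

/-- **`BSD(E,p)` on X4 ∧ `r = 0` at `p ≥ 5` for the `I₀*` member `W` when `#Ш_an` and `∏ c_ℓ` are
`p`-units, `ρ̄` onto — Manin datum from the good twist's degree and point count** (Kim 2026 via
`X4RankZero.bsdp_of_shaAn_unit`). [cite: Kim2022StructureSelmer, Thm. 1.9 (6) (PDF p. 8)]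
[cite: CesnaviciusNeururerSaha2023, Thm. 1.2] -/
theorem ClassX4.bsdp_rankZero_of_goodTwistDegrees_of_shaAn_unit
    (hKim : Kim2026.rankZero_padicValNat_sha_le_of_maninConstant)
    (hGZK : rank_eq_analyticRank_of_analyticRank_le_one) (hmod : hasEntireLFunction_rat)
    (hCNS : cesnaviciusNeururerSaha_padicVal_maninConstant_le_modularDegree)
    (W : WeierstrassCurve ℚ) [W.IsElliptic] [W.IsGloballyMinimal]
    (hp5 : 5 ≤ p) (hr : W.analyticRank = 0) (hX : ClassX4 W p) (hsurj : Surj W p)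
    [NeZero (W.conductorNorm ℤ)] (D' : ModularParametrizationData W (W.conductorNorm ℤ))
    (htam : ¬ p ∣ W.tamagawaProduct)
    (V : WeierstrassCurve ℚ) [V.IsElliptic] [V.IsGloballyMinimal] [NeZero (V.conductorNorm ℤ)]
    (hV : Good V p) (C : VariableChange ℚ) (hC : C • V.quadraticTwist ((-1 : ℚ) ^ (p / 2) * p) = W)
    (D : ModularParametrizationData V (V.conductorNorm ℤ)) (hdeg : ¬ p ∣ D.modularDegree)
    (hv : padicValNat p D'.modularDegree = padicValInt p (((p : ℤ) + 1) ^ 2 - (V.LFunction p) ^ 2))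
    {q : ℚ} (hq : shaAn W = (q : ℂ)) (hvq : padicValRat p q = 0) : BSDp W p :=
  X4RankZero.bsdp_of_shaAn_unit W p hKim hGZK hmod hp5 hr hX hsurj D'
    (Addv.not_dvd_maninConstant_of_goodTwistDegrees p hCNS hp5 V W hV hX.2.1 C hC D D' hdeg hv)
    htam hq hvq

/-- **X4, BOTH analytic ranks, EVERY `p ≥ 5`, `ρ̄` onto, `p ∤ ∏ c_ℓ`, the `I₀*` member `W` with the
good-twist certificate (`p ∤ deg(D)`, `v_p(deg D') = v_p((p+1)² − a_p(V)²)`): `BSD(E,p)` from the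
LOWER halves of the same-`j` X4 pairs alone** (additive-p1's
`AdditivePotMult.bsdp_of_classX4_of_lowerHalves`). [cite: CesnaviciusNeururerSaha2023, Thm. 1.2]
[cite: Kim2022StructureSelmer, Thm. 1.9 (6) (PDF p. 8)] [cite: McCallumLMS1991, §1 Theorem (Kolyvagin), p. 296] -/
theorem ClassX4.bsdp_of_goodTwistDegrees_of_lowerHalves
    (hKim : Kim2026.rankZero_padicValNat_sha_le_of_maninConstant)
    (hGZ : ∀ (N : ℕ) [NeZero N] (W : WeierstrassCurve ℚ) (K : Type) [Field K] [NumberField K],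
      gross_zagier N W K)
    (hKo : ∀ (N : ℕ) [NeZero N] (W : WeierstrassCurve ℚ) (K : Type) [Field K] [NumberField K],
      kolyvagin N W K)
    (hB : ∀ (N : ℕ) [NeZero N] (W : WeierstrassCurve ℚ) (K : Type) [Field K] [NumberField K],
      Kolyvagin1990_padicValNat_card_sha_le N W K)
    (hGZK : rank_eq_analyticRank_of_analyticRank_le_one) (hmod : hasEntireLFunction_rat)
    (hnf : exists_isNewformOf) (hFH : friedbergHoffstein_exists_heegnerField_split_twist_ne_zero)
    (hCNS : cesnaviciusNeururerSaha_padicVal_maninConstant_le_modularDegree)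
    (W : WeierstrassCurve ℚ) [W.IsElliptic] [W.IsGloballyMinimal] [NeZero (W.conductorNorm ℤ)]
    (hX : ClassX4 W p) (hr : W.analyticRank ≤ 1) (hsurj : Surj W p) (hp5 : 5 ≤ p)
    (D' : ModularParametrizationData W (W.conductorNorm ℤ)) (htam : ¬ p ∣ W.tamagawaProduct)
    (V : WeierstrassCurve ℚ) [V.IsElliptic] [V.IsGloballyMinimal] [NeZero (V.conductorNorm ℤ)]
    (hV : Good V p) (C : VariableChange ℚ) (hC : C • V.quadraticTwist ((-1 : ℚ) ^ (p / 2) * p) = W)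
    (D : ModularParametrizationData V (V.conductorNorm ℤ)) (hdeg : ¬ p ∣ D.modularDegree)
    (hv : padicValNat p D'.modularDegree = padicValInt p (((p : ℤ) + 1) ^ 2 - (V.LFunction p) ^ 2))
    (hlow : ∀ (V' : WeierstrassCurve ℚ) [V'.IsElliptic] [V'.IsGloballyMinimal], ClassX4 V' p →
      V'.j = W.j → V'.analyticRank ≤ 1 → MissingLowerBoundAt V' p) :
    BSDp W p :=
  AdditivePotMult.bsdp_of_classX4_of_lowerHalves hKim hGZ hKo hB hGZK hmod hnf hFH hX hr hsurj hp5 D'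
    (Addv.not_dvd_maninConstant_of_goodTwistDegrees p hCNS hp5 V W hV hX.2.1 C hC D D' hdeg hv)
    htam hlow

end Summit.BirchSwinnertonDyer.Rank1Residual.Additive

end
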